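import Summits.PneNP.PneNP.Theses.DescentTower

/-!
# Route DescentTower — `TargetOfCruxes` (stmt-PneNP-2540)

Layer-2 glue: `CaptureSublinear → JointSublinearFooling → ThreeColNotInP`. If `3-COL ∈ P` then its complement `R` is a
sound refuter in `P` (`compl_mem_P_iff`, `mem_toLanguage_iff`); `CaptureSublinear` gives a sublinear level sequence `k`
whose coupled level rejects every `R`-refuted graph for large `n`, while `JointSublinearFooling` at the same `k`
supplies, for large `n`, a non-3-colourable graph passing that level; `Eventually.and` yields the contradiction.
-/

set_option linter.dupNamespace false -- `Summit.PneNP.PneNP.…`: summit = sub-problem name (D-0017 single-conjunct layout)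

namespace Summit.PneNP.PneNP.Theorems

open Filter

/-- **Support item `TargetOfCruxes` of route DescentTower (stmt-PneNP-2540)**:
`CaptureSublinear → JointSublinearFooling → ThreeColNotInP` (the complement of `3-COL ∈ P` would be a sound polynomial-time
refuter captured by a sublinear level, which the joint fooling graphs pass). [folklore] -/
theorem descentTower_targetOfCruxes_proof : Summit.PneNP.PneNP.Theses.DescentTower.TargetOfCruxes := by
  unfold Summit.PneNP.PneNP.Theses.DescentTower.TargetOfCruxes Summit.PneNP.PneNP.Theses.DescentTower.CaptureSublinear
    Summit.PneNP.PneNP.Theses.DescentTower.JointSublinearFooling Summit.PneNP.PneNP.Theses.DescentTower.ThreeColNotInP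
  intro hC hJ h3
  set L3 := Literature.Computability.Complexity.encodingGraph.toLanguage {G : Σ n, SimpleGraph (Fin n) | G.2.Colorable 3}
    with hL3
  have hR : L3ᶜ ∈ Literature.Computability.Complexity.Classes.P :=
    Literature.Computability.Complexity.compl_mem_P_iff.2 h3
  have hsound : ∀ (n : ℕ) (G : SimpleGraph (Fin n)),
      Literature.Computability.Complexity.encodingGraph.encode ⟨n, G⟩ ∈ L3ᶜ → ¬ G.Colorable 3 := by
    intro n G hG hcol
    exact hG ((Computability.Encoding.mem_toLanguage_iff _ _ _).2 hcol)
  obtain ⟨k, hk, hcap⟩ := hC (L3ᶜ) hR hsound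
  obtain ⟨n, hn1, hn2⟩ := (hcap.and (hJ k hk)).exists
  obtain ⟨G, hGcol, hE⟩ := hn2
  have hGR : Literature.Computability.Complexity.encodingGraph.encode ⟨n, G⟩ ∈ L3ᶜ := fun hmem =>
    hGcol ((Computability.Encoding.mem_toLanguage_iff _ _ _).1 hmem)
  exact hn1 G hGR hE

end Summit.PneNP.PneNP.Theorems
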